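import Summits.CriticalPhenomena.PercolationContinuityZ3.Theorems.PercNearOneGluingNoHeavyPcintSiteCertZ3K6Check1
import Summits.CriticalPhenomena.PercolationContinuityZ3.Theorems.PercNearOneGluingNoHeavyPcintSiteCertZ3K6Check2
import Summits.CriticalPhenomena.PercolationContinuityZ3.Theorems.PercNearOneGluingNoHeavyPcintSiteCertZ3K6Check3
import Summits.CriticalPhenomena.PercolationContinuityZ3.Theorems.PercNearOneGluingNoHeavyPcintSiteCertZ3K6Check4
import Summits.CriticalPhenomena.PercolationContinuityZ3.Theorems.PercNearOneGluingNoHeavyPcintSiteCertZ3K6Check5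
import Summits.CriticalPhenomena.PercolationContinuityZ3.Theorems.PercNearOneGluingNoHeavyPcintSiteCertZ3K6Check6
import Summits.CriticalPhenomena.PercolationContinuityZ3.Theorems.PercNearOneGluingNoHeavyPcintSiteCertZ3K6Check7
import Summits.CriticalPhenomena.PercolationContinuityZ3.Theorems.PercNearOneGluingNoHeavyPcintSiteCertZ3K6Check8
import HarnessLib

/-!
# PCINT lane: **`p_c^site(ℤ³) ≥ 0.2463`** — kernel-checked B2r window certificate (memory 6, randomised corner rule)

Cell `prim-pcint`, seat `prim-pcint-2`; memo `run/shared/lean/prim/pcint/REDUCTIONS.md` §B2r/§B2r.6, INTERVAL-PLAN §11.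
Does NOT build on p205010.  Assembles the eight kernel-checked chunks of Collatz–Wielandt rows
(`…PcintSiteCertZ3K6Check1..8`), the soundness of the computable acceptance test / gap count / corner flag
(`Z3S6.hokN`, `hgN`, `hcN`) and `le_siteCriticalProb_zd_of_nawRandWindowCert`.  Earlier kernel bound of this lane:
`siteCriticalProb_Z3_ge : 0.236 ≤ p_c^site(ℤ³)` (memory-4 closed form); printed: `0.2110`; the lane's two-implementation
certificates of the same kind reach `0.25112` (memory 16).
-/

namespace Summit.CriticalPhenomena.PercolationContinuityZ3.Theorems.Pcint

open Finset Literature.Probability.Percolation Literature.Probability.LatticeModels Z3K6 Z3S6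

/-- All `7776` coded Collatz–Wielandt rows check. [folklore] -/
theorem Z3S6.checkAllS : checkRangeS 0 7776 = true :=
  checkRangeS_of_split (checkRangeS_of_split (checkRangeS_of_split checkRangeS_1 checkRangeS_2)
    (checkRangeS_of_split checkRangeS_3 checkRangeS_4))
    (checkRangeS_of_split (checkRangeS_of_split checkRangeS_5 checkRangeS_6)
    (checkRangeS_of_split checkRangeS_7 checkRangeS_8))

/-- **The 7776 Collatz–Wielandt inequalities** `10^5 · rowS u ≤ 99995 · 2·10^28 · v(u)` (λ = 0.99995). [folklore] -/
theorem Z3S6.rowS_le (u : Fin 5 → Fin 3 × Bool) : 100000 * rowS u ≤ 99995 * (2 * 10 ^ 28) * vNatS u :=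
  rowS_le_of_checkAll checkAllS u

/-- **`p_c^site(ℤ³) ≥ 0.2463`** (kernel-checked B2r window certificate, memory 6; printed best lower bound 0.2110,
this lane's memory-4 closed form 0.236). [folklore] -/
theorem siteCriticalProb_Z3_ge_02463 : (0.2463 : ℝ) ≤ siteCriticalProb (zdGraph 3) 0 := by
  have hp : ((⟨2463 / 10000, by norm_num, by norm_num⟩ : unitInterval) : ℝ) = 0.2463 := by norm_num
  rw [← hp]
  refine le_siteCriticalProb_zd_of_nawRandWindowCert (m := 4) ((0 : Fin 3), true) okN gN cN hokN
    (fun u a _ _ => hgN u a) (fun u a _ _ => hcN u a) _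
    (q := 9451 / 10000) (qb := 9451 / 10000) (κb := 19451 / 20000) (by norm_num) le_rfl (by norm_num)
    (by norm_num) (by norm_num) (fun u => (vNatS u : ℝ)) (vmin := 57803) (vmax := 100000)
    (lam := 99995 / 100000) (by norm_num) (fun u => by exact_mod_cast (vNatS_bounds u).1)
    (fun u => by exact_mod_cast (vNatS_bounds u).2) (by norm_num) (by norm_num) fun u => ?_
  have hN : (100000 * rowS u : ℝ) ≤ 99995 * (2 * 10 ^ 28) * vNatS u := by exact_mod_cast Z3S6.rowS_le u
  have hrow : (∑ a : Fin 3 × Bool, if okN u a then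
      (2463 / 10000 : ℝ) * ((9451 / 10000) ^ gN u a * (if cN u a then 19451 / 20000 else 1)) * (vNatS (wshift u a) : ℝ)
      else 0) ≤ (rowS u : ℝ) / (2 * 10 ^ 28) := by
    rw [rowS, Nat.cast_sum, Finset.sum_div]
    refine Finset.sum_le_sum fun a _ => ?_
    by_cases h : okN u a = true
    · simp only [h, if_true]
      exact weight_le_termS (gN u a) (cN u a) (vNatS (wshift u a))
    · simp [h]
  have : (rowS u : ℝ) / (2 * 10 ^ 28) ≤ 99995 / 100000 * (vNatS u : ℝ) := by
    rw [div_le_iff₀ (by positivity)]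
    nlinarith
  exact hrow.trans this

end Summit.CriticalPhenomena.PercolationContinuityZ3.Theorems.Pcint
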